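import Summits.PneNP.PneNP.Theorems.RankOneQuadAvoidFPMachine
import Summits.PneNP.PneNP.Theorems.SignDeg2AvoidAffineSplitCorrect
import Summits.PneNP.PneNP.Theorems.RankOneQuadAvoid

/-!
# B4-FP, part 2/3: correctness of the rank-one-quadratic avoider (via `RankOneQuadAvoid`)

Cell pnp-ideate, ROUND-18 by-product B4.  For an instance `I : LocalMap k n m` all of whose tables are rank-one
quadratic (`IsRankOneQuad`: `P_j = c_j ⊕ (A_j ∧ B_j)`, `A_j, B_j` affine) the two affine factors of output `j`,
read through the positions `vars j`, are AFFINE FORMS on `𝔽₂ⁿ` (`ℓ₁ I j`, `ℓ₂ I j : RankOneQuadAvoid.AffForm n`,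
linear part = the machine's index-list row as a vector, constant = the factor at `0…0`), and
`bit (A_j(x|vars j)) = (ℓ₁ I j)(χ_x)` (`eval_ℓ₁_chi`, from part 2 of K3: `bit_apply_of_aff`, `chi_dot_vecL`), so that
`prodMap ℓ₁ ℓ₂ (χ_x) = (bit (c_j ⊕ I(x)_j))_j` (`prodMap_chi`).  The machine's tests are the hypotheses of p3's
rule (`Theorems/RankOneQuadAvoid.lean`):

* `incons = true` ⇒ the system «all forms `= 1`» has no solution (`no_solution_of_incons`: the pairing with
  `(z, 1)` kills the augmented rows but not `e_n`); `incons = false` ⇒ it has one (`solution_of_incons_false`: a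
  linear functional vanishing on the augmented rows with `f(e_n) = 1`, by `Submodule.exists_dual_map_eq_bot_of_notMem`);
* `good` = both span memberships of `RankOneQuadAvoid.W` (`good_iff`, the span of the machine's «other rows» IS `W`);
  `exists_good` makes `iStar` a genuine good output (`iStar_spec`).

Hence `r1Str_correct`: for `n ≥ 1`, `m ≥ 3n` the printed string is outside `Range(I)`
(`ones_not_mem_range` / `single_zero_not_mem_range`).  Restricted-model algorithmic infrastructure; nothing here
bears on `P` versus `NP`.
-/

set_option linter.dupNamespace false -- `Summit.PneNP.PneNP.…`: summit = sub-problem name (D-0017 single-conjunct layout)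

namespace Summit.PneNP.PneNP.Theorems.RankOneQuadAvoidFP

open Literature.Computability.Complexity
open Summit.PneNP.PneNP.Theorems.SignDeg2Signing (IsAffinePred)
open Summit.PneNP.PneNP.Theorems.MajLocalAvoidFP (rowOf getD_rowOf)
open Summit.PneNP.PneNP.Theorems.Nc03Reduction (inSpan inSpan_iff Vec vecL vecL_nil vecL_cons ind bit chi)
open Summit.PneNP.PneNP.Theorems.AffineSplitFP (affData affSupp affData_of_aff bit_apply_of_aff chi_dot_vecL
  dot_eq_zero_of_mem_span)
open Summit.PneNP.PneNP.Theorems.RankOneQuadAvoid (AffForm prodMap W ones_not_mem_range single_zero_not_mem_range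
  exists_good zmod2_eq_one_of_ne_zero)

variable {k n m : ℕ}

/-! ## Small `𝔽₂` facts -/

/-- In `𝔽₂`, `bit b + bit (¬b) = 1`. -/
theorem bit_add_bit_not (b : Bool) : bit b + bit (!b) = 1 := by
  cases b <;> rfl

/-- Pairing with a unit vector reads the coordinate. -/
theorem dot_ind {N : ℕ} (p : Vec N) (a : Fin N) : p ⬝ᵥ ind a = p a := by
  unfold dotProduct ind
  simp

/-- `e_n` is the vector of the index list `[n]`. -/
theorem vecL_last : vecL (n + 1) [n] = ind (Fin.last n) := by
  have h := vecL_cons (N := n + 1) (Fin.last n) []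
  rw [vecL_nil, add_zero, Fin.val_last] at h
  exact h

/-- Coordinate expansion of a vector of `𝔽₂^N` in the unit vectors. -/
theorem eq_sum_ind {N : ℕ} (w : Vec N) : w = ∑ i, w i • ind i := by
  funext a
  simp [Finset.sum_apply, ind]

/-- A linear functional is the pairing with its values on the unit vectors. -/
theorem dual_apply_eq_dot {N : ℕ} (f : Module.Dual (ZMod 2) (Vec N)) (w : Vec N) :
    f w = w ⬝ᵥ fun i => f (ind i) := by
  conv_lhs => rw [eq_sum_ind w]
  rw [map_sum]
  unfold dotProduct
  exact Finset.sum_congr rfl fun i _ => by rw [map_smul, smul_eq_mul]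

/-! ## Augmented rows -/

/-- Counting an index in an augmented row: old coordinates. -/
theorem vecL_augOf_castSucc (L : List ℕ) (b : Bool) (u : Fin n) :
    vecL (n + 1) (augOf n (L, b)) (Fin.castSucc u) = vecL n L u := by
  unfold vecL augOf
  have hu : u.val ≠ n := Nat.ne_of_lt u.isLt
  split_ifs
  · rfl
  · rw [Fin.val_castSucc, List.count_append, List.count_singleton', if_neg hu.symm, add_zero]

/-- Counting an index in an augmented row (entries `< n`): the new coordinate carries `bit (¬b)`. -/
theorem vecL_augOf_last (L : List ℕ) (hL : ∀ v ∈ L, v < n) (b : Bool) :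
    vecL (n + 1) (augOf n (L, b)) (Fin.last n) = bit (!b) := by
  unfold vecL augOf
  have h0 : L.count n = 0 := List.count_eq_zero.2 fun h => lt_irrefl _ (hL n h)
  split_ifs with hb
  · rw [Fin.val_last, h0]; subst hb; rfl
  · rw [Fin.val_last, List.count_append, h0, List.count_singleton', if_pos rfl]
    cases b
    · rfl
    · exact absurd rfl hb

/-- **Pairing an augmented row** with a vector `p` on `n + 1` coordinates: the old part paired with the row, plus
`p_n · bit (¬b)`. -/
theorem dot_vecL_augOf (p : Vec (n + 1)) (L : List ℕ) (hL : ∀ v ∈ L, v < n) (b : Bool) :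
    p ⬝ᵥ vecL (n + 1) (augOf n (L, b)) = (fun u => p (Fin.castSucc u)) ⬝ᵥ vecL n L + p (Fin.last n) * bit (!b) := by
  unfold dotProduct
  rw [Fin.sum_univ_castSucc, vecL_augOf_last L hL b]
  congr 1
  exact Finset.sum_congr rfl fun u _ => by rw [vecL_augOf_castSucc L b u]

/-! ## The affine forms of an instance -/

/-- The first affine form of output `j`: linear part `Σ_{i ∈ S(A_j)} e_{v_{j,i}}`, constant `bit (A_j 0)`. -/
noncomputable def ℓ₁ (I : LocalMap k n m) (j : Fin m) : AffForm n := ⟨vecL n (L1 I j), bit (b1 I j)⟩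

/-- The second affine form of output `j`. -/
noncomputable def ℓ₂ (I : LocalMap k n m) (j : Fin m) : AffForm n := ⟨vecL n (L2 I j), bit (b2 I j)⟩

/-- Evaluating a form given by an index list: `⟨row, z⟩ + constant`. -/
theorem AffForm_eval_mk (L : List ℕ) (b : Bool) (z : Vec n) :
    (⟨vecL n L, bit b⟩ : AffForm n).eval z = vecL n L ⬝ᵥ z + bit b := rfl

/-- The first row is the list of positions read at the support of `A_j`. -/
theorem L1_eq (I : LocalMap k n m) (hQ : ∀ j, IsRankOneQuad (I.table j)) (j : Fin m) :
    L1 I j = (((affSupp _ (fact_spec _ (hQ j)).1).toList.map fun i => I.vars j i).map Fin.val) := by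
  unfold L1
  rw [r1Data_of _ (hQ j), affData_of_aff _ (fact_spec _ (hQ j)).1, List.map_map, List.map_map]
  exact List.map_congr_left fun i _ => getD_rowOf I j i

/-- The second row is the list of positions read at the support of `B_j`. -/
theorem L2_eq (I : LocalMap k n m) (hQ : ∀ j, IsRankOneQuad (I.table j)) (j : Fin m) :
    L2 I j = (((affSupp _ (fact_spec _ (hQ j)).2.1).toList.map fun i => I.vars j i).map Fin.val) := by
  unfold L2
  rw [r1Data_of _ (hQ j), affData_of_aff _ (fact_spec _ (hQ j)).2.1, List.map_map, List.map_map]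
  exact List.map_congr_left fun i _ => getD_rowOf I j i

/-- The constant bits are the factors at `0…0`; the outer constant is the chosen one. -/
theorem consts_eq (I : LocalMap k n m) (hQ : ∀ j, IsRankOneQuad (I.table j)) (j : Fin m) :
    b1 I j = factA _ (hQ j) (fun _ => false) ∧ b2 I j = factB _ (hQ j) (fun _ => false) ∧ cc I j = outerC _ (hQ j) := by
  unfold b1 b2 cc
  rw [r1Data_of _ (hQ j), affData_of_aff _ (fact_spec _ (hQ j)).1, affData_of_aff _ (fact_spec _ (hQ j)).2.1]
  exact ⟨rfl, rfl, rfl⟩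

/-- Entries of the first row are positions `< n`. -/
theorem L1_lt (I : LocalMap k n m) (hQ : ∀ j, IsRankOneQuad (I.table j)) (j : Fin m) : ∀ v ∈ L1 I j, v < n := by
  rw [L1_eq I hQ j]; intro v hv
  obtain ⟨u, -, rfl⟩ := List.mem_map.1 hv
  exact u.isLt

/-- Entries of the second row are positions `< n`. -/
theorem L2_lt (I : LocalMap k n m) (hQ : ∀ j, IsRankOneQuad (I.table j)) (j : Fin m) : ∀ v ∈ L2 I j, v < n := by
  rw [L2_eq I hQ j]; intro v hv
  obtain ⟨u, -, rfl⟩ := List.mem_map.1 hv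
  exact u.isLt

/-- **The first form at `χ_x` is the first factor at the read bits.** -/
theorem eval_ℓ₁_chi (I : LocalMap k n m) (hQ : ∀ j, IsRankOneQuad (I.table j)) (x : Fin n → Bool) (j : Fin m) :
    (ℓ₁ I j).eval (chi x) = bit (factA _ (hQ j) fun i => x (I.vars j i)) := by
  rw [ℓ₁, AffForm_eval_mk, dotProduct_comm, L1_eq I hQ j, chi_dot_vecL, List.map_map, (consts_eq I hQ j).1,
    bit_apply_of_aff _ (fact_spec _ (hQ j)).1 (fun i => x (I.vars j i)), add_comm, Finset.sum_map_toList]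
  rfl

/-- **The second form at `χ_x` is the second factor at the read bits.** -/
theorem eval_ℓ₂_chi (I : LocalMap k n m) (hQ : ∀ j, IsRankOneQuad (I.table j)) (x : Fin n → Bool) (j : Fin m) :
    (ℓ₂ I j).eval (chi x) = bit (factB _ (hQ j) fun i => x (I.vars j i)) := by
  rw [ℓ₂, AffForm_eval_mk, dotProduct_comm, L2_eq I hQ j, chi_dot_vecL, List.map_map, (consts_eq I hQ j).2.1,
    bit_apply_of_aff _ (fact_spec _ (hQ j)).2.1 (fun i => x (I.vars j i)), add_comm, Finset.sum_map_toList]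
  rfl

/-- **The product map at `χ_x` reads `bit (c_j ⊕ I(x)_j)`.** -/
theorem prodMap_chi (I : LocalMap k n m) (hQ : ∀ j, IsRankOneQuad (I.table j)) (x : Fin n → Bool) :
    prodMap (ℓ₁ I) (ℓ₂ I) (chi x) = fun j => bit (cc I j ^^ I.eval x j) := by
  funext j
  have bit_mul : ∀ a b : Bool, bit a * bit b = bit (a && b) := fun a b => by cases a <;> cases b <;> rfl
  rw [prodMap, eval_ℓ₁_chi I hQ, eval_ℓ₂_chi I hQ, bit_mul, (consts_eq I hQ j).2.2, LocalMap.eval, (fact_spec _ (hQ j)).2.2]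
  cases outerC _ (hQ j) <;> simp

/-! ## The augmented system of an instance -/

/-- Members of the augmented row list of an instance. -/
theorem mem_augRows (I : LocalMap k n m) {r : List ℕ} (hr : r ∈ augRows n (recsOf I)) :
    ∃ j, r = augOf n (L1 I j, b1 I j) ∨ r = augOf n (L2 I j, b2 I j) := by
  unfold augRows recsOf at hr
  rw [List.map_map, List.mem_flatten] at hr
  obtain ⟨l, hl, hrl⟩ := hr
  obtain ⟨j, -, rfl⟩ := List.mem_map.1 hl
  simp only [Function.comp_apply, rrecOf, List.mem_cons, List.not_mem_nil, or_false] at hrl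
  exact ⟨j, hrl⟩

/-- The augmented first row of output `j` is in the list. -/
theorem augOf_mem₁ (I : LocalMap k n m) (j : Fin m) : augOf n (L1 I j, b1 I j) ∈ augRows n (recsOf I) := by
  unfold augRows recsOf
  rw [List.map_map, List.mem_flatten]
  exact ⟨_, List.mem_map.2 ⟨j, List.mem_finRange j, rfl⟩, by simp [rrecOf]⟩

/-- The augmented second row of output `j` is in the list. -/
theorem augOf_mem₂ (I : LocalMap k n m) (j : Fin m) : augOf n (L2 I j, b2 I j) ∈ augRows n (recsOf I) := by
  unfold augRows recsOf
  rw [List.map_map, List.mem_flatten]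
  exact ⟨_, List.mem_map.2 ⟨j, List.mem_finRange j, rfl⟩, by simp [rrecOf]⟩

/-- **Inconsistency is sound**: if `e_n` lies in the span of the augmented rows, no `z` makes every form `1`. -/
theorem no_solution_of_incons (I : LocalMap k n m) (hQ : ∀ j, IsRankOneQuad (I.table j))
    (h : incons n (recsOf I) = true) : ¬ ∃ z : Vec n, ∀ j, (ℓ₁ I j).eval z = 1 ∧ (ℓ₂ I j).eval z = 1 := by
  rintro ⟨z, hz⟩
  unfold incons at h
  rw [inSpan_iff, vecL_last] at h
  -- the pairing with `(z, 1)` kills every augmented row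
  have hkill : ∀ s ∈ vecL (n + 1) '' {r | r ∈ augRows n (recsOf I)}, Fin.snoc z 1 ⬝ᵥ s = 0 := by
    rintro _ ⟨r, hr, rfl⟩
    have hpc : (fun u => (Fin.snoc z 1 : Vec (n + 1)) (Fin.castSucc u)) = z := by funext u; simp
    have hpl : (Fin.snoc z 1 : Vec (n + 1)) (Fin.last n) = 1 := by simp
    have key : ∀ (L : List ℕ) (hL : ∀ v ∈ L, v < n) (b : Bool), vecL n L ⬝ᵥ z + bit b = 1 →
        Fin.snoc z 1 ⬝ᵥ vecL (n + 1) (augOf n (L, b)) = 0 := by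
      intro L hL b e
      have e' : vecL n L ⬝ᵥ z = 1 + bit b := by rw [← e, add_assoc, CharTwo.add_self_eq_zero, add_zero]
      rw [dot_vecL_augOf _ L hL b, hpc, hpl, one_mul, dotProduct_comm, e', add_assoc, bit_add_bit_not, CharTwo.add_self_eq_zero]
    obtain ⟨j, rfl | rfl⟩ := mem_augRows I hr
    · exact key _ (L1_lt I hQ j) _ (by have e := (hz j).1; rwa [ℓ₁, AffForm_eval_mk] at e)
    · exact key _ (L2_lt I hQ j) _ (by have e := (hz j).2; rwa [ℓ₂, AffForm_eval_mk] at e)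
  have h0 := dot_eq_zero_of_mem_span hkill h
  rw [dot_ind, Fin.snoc_last] at h0
  exact one_ne_zero h0

/-- **Consistency is sound**: if `e_n` is NOT in the span of the augmented rows, some `z` makes every form `1`
(a linear functional vanishing on the rows and not on `e_n`). -/
theorem solution_of_incons_false (I : LocalMap k n m) (hQ : ∀ j, IsRankOneQuad (I.table j))
    (h : incons n (recsOf I) = false) : ∃ z : Vec n, ∀ j, (ℓ₁ I j).eval z = 1 ∧ (ℓ₂ I j).eval z = 1 := by
  set U := Submodule.span (ZMod 2) (vecL (n + 1) '' {r | r ∈ augRows n (recsOf I)}) with hU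
  have hnot : ind (Fin.last n) ∉ U := by
    intro hmem
    have : incons n (recsOf I) = true := by
      unfold incons; rw [inSpan_iff, vecL_last]; exact hmem
    rw [h] at this
    exact Bool.false_ne_true this
  obtain ⟨f, hf, hfU⟩ := Submodule.exists_dual_map_eq_bot_of_notMem hnot inferInstance
  set p : Vec (n + 1) := fun i => f (ind i) with hp
  have hpl : p (Fin.last n) = 1 := zmod2_eq_one_of_ne_zero _ hf
  have hgen : ∀ r ∈ augRows n (recsOf I), p ⬝ᵥ vecL (n + 1) r = 0 := by
    intro r hr
    have hmem : f (vecL (n + 1) r) ∈ U.map f := Submodule.mem_map_of_mem (Submodule.subset_span ⟨r, hr, rfl⟩)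
    rw [hfU, Submodule.mem_bot, dual_apply_eq_dot] at hmem
    rw [dotProduct_comm]; exact hmem
  have key : ∀ (L : List ℕ) (hL : ∀ v ∈ L, v < n) (b : Bool), augOf n (L, b) ∈ augRows n (recsOf I) →
      vecL n L ⬝ᵥ (fun u => p (Fin.castSucc u)) + bit b = 1 := by
    intro L hL b hmem
    have h0 := hgen _ hmem
    rw [dot_vecL_augOf p L hL b, hpl, one_mul, dotProduct_comm] at h0
    have e' : vecL n L ⬝ᵥ (fun u => p (Fin.castSucc u)) = bit (!b) := by
      rw [← add_zero (vecL n L ⬝ᵥ _), ← CharTwo.add_self_eq_zero (bit (!b)), ← add_assoc, h0, zero_add]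
    rw [e', add_comm, bit_add_bit_not]
  refine ⟨fun u => p (Fin.castSucc u), fun j => ⟨?_, ?_⟩⟩
  · rw [ℓ₁, AffForm_eval_mk]; exact key _ (L1_lt I hQ j) _ (augOf_mem₁ I j)
  · rw [ℓ₂, AffForm_eval_mk]; exact key _ (L2_lt I hQ j) _ (augOf_mem₂ I j)

/-! ## The span of the other rows is `W` -/

/-- Members of the other outputs' row list. -/
theorem mem_others_iff (I : LocalMap k n m) (i : Fin m) (r : List ℕ) :
    r ∈ others (recsOf I) i.val ↔ ∃ j, j ≠ i ∧ (r = L1 I j ∨ r = L2 I j) := by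
  rw [others_recsOf, List.mem_flatten]
  constructor
  · rintro ⟨l, hl, hrl⟩
    obtain ⟨j, hj, rfl⟩ := List.mem_map.1 hl
    rw [List.mem_filter] at hj
    have hne : j ≠ i := fun e => by subst e; simp at hj
    simp only [List.mem_cons, List.not_mem_nil, or_false] at hrl
    exact ⟨j, hne, hrl⟩
  · rintro ⟨j, hne, hrl⟩
    refine ⟨[L1 I j, L2 I j], List.mem_map.2 ⟨j, ?_, rfl⟩, by simpa using hrl⟩
    rw [List.mem_filter]
    refine ⟨List.mem_finRange j, ?_⟩
    simpa using fun e => hne (Fin.ext e)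

/-- **The span of the machine's «other rows» is `RankOneQuadAvoid.W`.** -/
theorem span_others (I : LocalMap k n m) (i : Fin m) :
    Submodule.span (ZMod 2) (vecL n '' {r | r ∈ others (recsOf I) i.val}) = W (ℓ₁ I) (ℓ₂ I) i := by
  unfold W
  congr 1
  ext v
  simp only [Set.mem_image, Set.mem_setOf_eq, Set.mem_union, mem_others_iff]
  constructor
  · rintro ⟨r, ⟨j, hne, hr | hr⟩, rfl⟩
    · exact Or.inl ⟨j, hne, by rw [hr]; rfl⟩
    · exact Or.inr ⟨j, hne, by rw [hr]; rfl⟩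
  · rintro (⟨j, hne, rfl⟩ | ⟨j, hne, rfl⟩)
    · exact ⟨L1 I j, ⟨j, hne, Or.inl rfl⟩, rfl⟩
    · exact ⟨L2 I j, ⟨j, hne, Or.inr rfl⟩, rfl⟩

/-- **The machine's goodness test is p3's goodness**: both linear parts in `W`. -/
theorem good_iff (I : LocalMap k n m) (i : Fin m) :
    good n (recsOf I) (i.val, rrecOf I i) = true ↔ (ℓ₁ I i).lin ∈ W (ℓ₁ I) (ℓ₂ I) i ∧ (ℓ₂ I i).lin ∈ W (ℓ₁ I) (ℓ₂ I) i := by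
  unfold good
  rw [Bool.and_eq_true, inSpan_iff, inSpan_iff, span_others]
  rfl

/-- If some output is good, `iStar` is a good output. -/
theorem iStar_spec (I : LocalMap k n m) (h : ∃ i : Fin m, good n (recsOf I) (i.val, rrecOf I i) = true) :
    ∃ i₀ : Fin m, iStar n (recsOf I) = i₀.val ∧ good n (recsOf I) (i₀.val, rrecOf I i₀) = true := by
  obtain ⟨i, hi⟩ := h
  unfold iStar
  rw [tagged_recsOf]
  have hlt : ((List.finRange m).map fun j => (j.val, rrecOf I j)).findIdx (good n (recsOf I)) <
      ((List.finRange m).map fun j => (j.val, rrecOf I j)).length :=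
    List.findIdx_lt_length_of_exists ⟨(i.val, rrecOf I i), List.mem_map.2 ⟨i, List.mem_finRange i, rfl⟩, hi⟩
  have hm : ((List.finRange m).map fun j => (j.val, rrecOf I j)).findIdx (good n (recsOf I)) < m := by
    simpa using hlt
  refine ⟨⟨_, hm⟩, rfl, ?_⟩
  have hg := List.findIdx_getElem (w := hlt)
  simp only [List.getElem_map, List.getElem_finRange] at hg
  exact hg

/-! ## Correctness -/

/-- **CORRECTNESS OF THE RANK-ONE AVOIDER**: on every `k`-local instance with all tables rank-one quadratic,
`n ≥ 1` and `m ≥ 3n`, the machine prints a string outside the range. -/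
theorem r1Str_correct (I : LocalMap k n m) (hQ : ∀ j, IsRankOneQuad (I.table j)) (hn : 0 < n) (hm : 3 * n ≤ m) :
    readOut m (r1Str k I.encode) ∉ I.range := by
  rintro ⟨x, hx⟩
  have hm2 : 2 * n < m := by omega
  have hy : ∀ j, readOut m (r1Str k I.encode) j = (!cc I j ^^ (!incons n (recsOf I) && (j.val == iStar n (recsOf I)))) :=
    readOut_r1Str I
  have hrange : (fun j => bit (cc I j ^^ readOut m (r1Str k I.encode) j)) ∈ Set.range (prodMap (ℓ₁ I) (ℓ₂ I)) :=
    ⟨chi x, by rw [prodMap_chi I hQ x, ← hx]⟩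
  by_cases hinc : incons n (recsOf I) = true
  · refine ones_not_mem_range (ℓ₁ I) (ℓ₂ I) (no_solution_of_incons I hQ hinc) ?_
    convert hrange using 1
    funext j
    rw [hy j, hinc]
    cases cc I j <;> rfl
  · have hinc' : incons n (recsOf I) = false := by simpa using hinc
    obtain ⟨z, hz⟩ := solution_of_incons_false I hQ hinc'
    obtain ⟨i, hi₁, hi₂⟩ := exists_good hm2 (ℓ₁ I) (ℓ₂ I)
    obtain ⟨i₀, hi₀, hg₀⟩ := iStar_spec I ⟨i, (good_iff I i).2 ⟨hi₁, hi₂⟩⟩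
    obtain ⟨g₁, g₂⟩ := (good_iff I i₀).1 hg₀
    refine single_zero_not_mem_range (ℓ₁ I) (ℓ₂ I) z hz i₀ g₁ g₂ ?_
    convert hrange using 1
    funext j
    rw [hy j, hinc', hi₀]
    by_cases hj : j = i₀
    · subst hj
      rw [if_pos rfl, beq_self_eq_true]
      cases cc I j <;> rfl
    · have hne : (j.val == i₀.val) = false := by
        rw [beq_eq_false_iff_ne]; exact fun e => hj (Fin.ext e)
      rw [if_neg hj, hne]
      cases cc I j <;> rfl

end Summit.PneNP.PneNP.Theorems.RankOneQuadAvoidFP
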